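import Summits.CriticalPhenomena.PercolationContinuityZ3.Theorems.PercNearOneGluingNoHeavyLowerTailThreePartitionTwistedConeTwo

/-!
# `NoHeavyLowerTail` (crux stmt-CriticalPhenomena-4575): TWISTED THREE-PARTITION POSITIVITY WITH ONE PRINCIPAL SLOT, EVERY TWIST
# — `0 ≤ threePartNT τ {T | S ⊆ T} 𝒱 𝒲` for all finite `ι`, `τ, S ⊆ ι`, up-sets `𝒱, 𝒲`

Support file (lane `prim-ineq-gen-4`, generation 15; `--supports stmt-CriticalPhenomena-4575`).  Pure proofs, no definitions, no `sorry`, standard axioms.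
Induction on the generating set `S`, peeling `e ∈ S` by the digit-1 cone step `…ThreePartitionTwistedCone.threePartNT_lift_le_three_mul` when `e ∉ τ` and by the digit-2
cone step `…ThreePartitionTwistedConeTwo.two_mul_threePartNT_lift_le_three_mul` when `e ∈ τ` (with `τ = insert e (τ ∖ e)`); base `…ThreePartitionTwistedUniv.threePartNT_univ_nonneg`.
By the tree bridge `…ThreePartitionCombBridge.combCoef3_eq_threePartNT` (every tensor-Bernstein coefficient of `E₃(1_𝒰,1_𝒱,1_𝒲)` on a finite cube is a `threePartNT` of sections,
and sections of a principal filter are principal or empty) this is the three-partition side of "COMB POSITIVITY OF SAHI'S `E₃` WITH ONE PRINCIPAL (ORTHANT) SLOT, EVERY DIMENSION"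
(the cube form of prim-ineq-gen-4 g10's theorem F4, there obtained from Level-2 certificates); the final glue through the bridge is left to its owners (prim-l12 P3).
HONEST LABEL: a one-principal-slot face of `ThreePartitionPositivityTwisted` (OPEN), not the conjecture.
Memo: `run/shared/lean/prim/prim-ineq-gen-4/FINDING-LEVEL2-CUBE-TPP-g15.md` §0(T), §5(a). [this work]
-/

noncomputable section

open Finset
open scoped symmDiff Classical

namespace Summit.CriticalPhenomena.PercolationContinuityZ3.Theorems.ThreePartition

variable {ι : Type*} [Fintype ι]

/-! ## Induction: one principal slot, every twist -/

omit [Fintype ι] in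
/-- `insert e (τ ∖ e) = τ` for `e ∈ τ`. [folklore] -/
theorem insert_sdiff_singleton_of_mem {e : ι} {τ : Set ι} (he : e ∈ τ) : insert e (τ \ {e}) = τ := by
  ext x
  simp only [Set.mem_insert_iff, Set.mem_sdiff, Set.mem_singleton_iff]
  by_cases hx : x = e
  · subst hx; tauto
  · tauto

/-- Principal filters of finsets, every twist: `0 ≤ threePartNT τ {T | S ⊆ T} 𝒱 𝒲`. [this work] -/
theorem threePartNT_principal_finset_nonneg (S : Finset ι) :
    ∀ (τ : Set ι) {𝒱 𝒲 : Set (Set ι)}, IsUpperSet 𝒱 → IsUpperSet 𝒲 → 0 ≤ threePartNT τ {T : Set ι | (S : Set ι) ⊆ T} 𝒱 𝒲 := by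
  induction S using Finset.induction_on with
  | empty =>
    intro τ 𝒱 𝒲 h𝒱 h𝒲
    have h : {T : Set ι | ((∅ : Finset ι) : Set ι) ⊆ T} = (Set.univ : Set (Set ι)) := by
      ext T; simp
    rw [h]
    exact threePartNT_univ_nonneg τ h𝒱 h𝒲
  | @insert e S he ih =>
    intro τ 𝒱 𝒲 h𝒱 h𝒲
    have hU : IsUpperSet {T : Set ι | ((insert e S : Finset ι) : Set ι) ⊆ T} :=
      fun A B hAB hA => Set.Subset.trans hA hAB
    have hUe : ∀ T ∈ {T : Set ι | ((insert e S : Finset ι) : Set ι) ⊆ T}, e ∈ T :=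
      fun T hT => hT (by simp)
    by_cases heτ : e ∈ τ
    · -- digit 2: τ = insert e (τ \ {e})
      have hne : e ∉ τ \ {e} := fun h => h.2 rfl
      have h3 := two_mul_threePartNT_lift_le_three_mul (τ \ {e}) e hne hU h𝒱 h𝒲 hUe
      rw [liftAt_principal_insert e S he, insert_sdiff_singleton_of_mem heτ] at h3
      have h0 := ih (τ \ {e}) (isUpperSet_liftAt e h𝒱) (isUpperSet_liftAt e h𝒲)
      linarith
    · -- digit 1
      have h3 := threePartNT_lift_le_three_mul τ e heτ hU h𝒱 h𝒲 hUe
      rw [liftAt_principal_insert e S he] at h3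
      have h0 := ih τ (isUpperSet_liftAt e h𝒱) (isUpperSet_liftAt e h𝒲)
      linarith

/-- **TWISTED THREE-PARTITION POSITIVITY WITH ONE PRINCIPAL SLOT** (every finite ground set, every twist): for all `τ, S ⊆ ι` and all up-sets
`𝒱, 𝒲`, `0 ≤ threePartNT τ {T | S ⊆ T} 𝒱 𝒲` — the one-principal-slot face of `ThreePartitionPositivityTwisted` (= every tensor-Bernstein coefficient of
`E₃(1_{↑S}, 1_𝒱, 1_𝒲)` on a finite cube, via `…ThreePartitionCombBridge`). [this work] -/
theorem threePartNT_principal_nonneg (τ S : Set ι) {𝒱 𝒲 : Set (Set ι)} (h𝒱 : IsUpperSet 𝒱) (h𝒲 : IsUpperSet 𝒲) :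
    0 ≤ threePartNT τ {T : Set ι | S ⊆ T} 𝒱 𝒲 := by
  have h := threePartNT_principal_finset_nonneg S.toFinite.toFinset τ h𝒱 h𝒲
  simp only [Set.Finite.coe_toFinset] at h
  exact h

end Summit.CriticalPhenomena.PercolationContinuityZ3.Theorems.ThreePartition
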